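import Literature.Probability.RandomPlanarGeometry.SLESixMoebiusLocality
import Literature.Probability.RandomPlanarGeometry.SLESixLocality
import Literature.Probability.RandomPlanarGeometry.StarHullCanonical
import Literature.Probability.RandomPlanarGeometry.ConformalRestrictionProofs
import HarnessLib

/-!
# Locality of chordal SLE₆ with respect to a bounded hull — half-plane form (named fact) and the
# bounded clause of the restriction form

Topic `Probability/RandomPlanarGeometry`. Two `Prop`s (no proof here):

* `sle_six_hull_locality` — NAMED FACT, the **half-plane form of the locality of chordal SLE₆
  with respect to a `*`-hull** (G. F. Lawler, O. Schramm, W. Werner, *Values of Brownian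
  intersection exponents I*, Acta Math. 187 (2001), Thm. 2.2 "Locality"; *Conformal restriction:
  the chordal case*, JAMS 16 (2003), §5: for `A ∈ 𝒬*` with canonical map `Φ_A` and its
  Schwarz-reflected extension `E_A = starMap A`, the image `E_A ∘ γ` of the SLE₆ trace, observed
  until `γ` hits the pull-back `S'` of a closed set `S` strictly before it hits `A`, has the law
  of an SLE₆ trace observed until it hits `S`), stated with the measurable stopped-class
  functional `stoppedPathClass` and the first hitting time `firstHit` of
  `SLESixMoebiusLocality.lean` / `SLEBoundaryHitting.lean`, exactly as its discharge
  (`theorem sle_six_hull_locality_holds`, file `SLESixHullLocalityH.lean`: the image driving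
  value `W̃ = W + L_A − L_{B_t}` is a time-changed `√6`-Brownian motion — driftless at `κ = 6` —
  and the image Loewner chain is generated by `E_A ∘ γ ∘ τ`) will consume it;
* `IsSLELaw.locality_six_bounded` — the clause of the restriction form `IsSLELaw.locality_six`
  (`SLESixLocality.lean`) for HULL SUBDOMAINS (`MarkedDomain.IsHullSubdomain`: `D' ⊆ D` with the
  same marked points and `a, b ∉ closure (D ∖ D')` — the printed hypothesis `a, b ∉ \bar I` of
  [LSW 2001] Cor. 2.4); its proof from `sle_six_hull_locality` (pull-back hull
  `φ.pullbackHull D'`, chordal map `φ ∘ Φ_A⁻¹` of `D'`, thickenings of `closure (D ∖ D') ∪ {b}`)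
  is `IsSLELaw.locality_six_bounded_of_hull` (`SLESixHullLocalityReduction.lean`), and the full
  fact `IsSLELaw.locality_six` follows with the target-independence engine
  (`sle_six_moebius_locality_holds`) for the remaining case `b ∈ closure (D ∖ D')`.

## References

* G. F. Lawler, O. Schramm, W. Werner, Acta Math. 187 (2001) 237–273, Thm. 2.2, Cor. 2.4.
  [LawlerSchrammWerner2001]
* G. F. Lawler, O. Schramm, W. Werner, J. Amer. Math. Soc. 16 (2003) 917–955, §5.
  [LawlerSchrammWerner2003Restriction]
-/

noncomputable section

open Set MeasureTheory
open scoped NNReal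

namespace Literature.Probability.RandomPlanarGeometry

/-- **Locality of chordal SLE₆ with respect to a `*`-hull, half-plane form** ([LSW 2001] Thm. 2.2;
[LSW 2003] §5): for a nonempty `*`-hull `A`, closed sets `S` (image coordinates) and `S'` with
`z ∈ S' ↔ E_A z ∈ S` off `A` on the closed half-plane, if the SLE₆ trace almost surely hits `S'`
strictly before `A`, then the class of `E_A ∘ γ` stopped at the first hit of `S'` has the law of
the class of the SLE₆ trace stopped at its first hit of `S`.
[cite: LawlerSchrammWerner2001, Thm 2.2] -/
def sle_six_hull_locality : Prop :=
  ∀ {A : Set ℂ}, IsStarHull A → A.Nonempty → ∀ {S S' : Set ℂ}, IsClosed S → IsClosed S' →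
    (∀ z : ℂ, 0 ≤ z.im → z ∉ A → (z ∈ S' ↔ starMap A z ∈ S)) →
    (∀ᵐ ω ∂Process.preWienerMeasure, firstHit (sleTrace 6 ω) S' < firstHit (sleTrace 6 ω) A) →
    ∀ T : Set (CurveClass ℂ), MeasurableSet T →
      Process.preWienerMeasure {ω | stoppedPathClass (starMap A) (sleTrace 6 ω)
          ((firstHit (sleTrace 6 ω) S').untopD 0) ∈ T} =
        Process.preWienerMeasure {ω | stoppedPathClass id (sleTrace 6 ω)
          ((firstHit (sleTrace 6 ω) S).untopD 0) ∈ T}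

/-- **The bounded clause of the restriction form of locality** ([LSW 2001] Cor. 2.4 with its
printed hypothesis `a, b ∉ \bar I`): for chordal SLE₆ laws `μ`, `μ'` of a Dobrushin domain `D`
and of a hull subdomain `D'` (`D.IsHullSubdomain D'`), the classes stopped at the first hitting
of `closure (D ∖ D')` have the same law. [cite: LawlerSchrammWerner2001, Cor 2.4] -/
def IsSLELaw.locality_six_bounded : Prop :=
  ∀ (D D' : DobrushinDomain) {μ μ' : Measure (CurveClass ℂ)},
    IsSLELaw 6 D μ → IsSLELaw 6 D' μ' → D.IsHullSubdomain D' →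
    ∀ T : Set (CurveClass ℂ), MeasurableSet T →
      μ' (CurveClass.stopAt (closure (D.carrier \ D'.carrier)) ⁻¹' T) =
        μ (CurveClass.stopAt (closure (D.carrier \ D'.carrier)) ⁻¹' T)

/-- **Locality of chordal SLE₆ with respect to a `*`-hull, half-plane form, ALIVE version**
(what the conformal-image Loewner chain proves directly, [LSW 2001] Thm. 2.2 / [LSW 2003] §5):
same as `sle_six_hull_locality`, but under the almost sure hypothesis that at the first hit of
`S'` the CLOSED HULL of the curve is still disjoint from `A` ("alive": no component of `A` has
been hit or swallowed). For `κ = 6` the hull can swallow a component of `A` before the curve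
touches `A`, so this hypothesis is stronger than `firstHit γ S' < firstHit γ A`; the passage from
this form to `sle_six_hull_locality` (swallowed components, strong Markov property at the first
hull contact with `A`) is a separate step. [cite: LawlerSchrammWerner2001, Thm 2.2] -/
def sle_six_hull_locality_alive : Prop :=
  ∀ {A : Set ℂ}, IsStarHull A → A.Nonempty → ∀ {S S' : Set ℂ}, IsClosed S → IsClosed S' →
    (∀ z : ℂ, 0 ≤ z.im → z ∉ A → (z ∈ S' ↔ starMap A z ∈ S)) →
    (∀ᵐ ω ∂Process.preWienerMeasure, ∃ t : ℝ≥0, firstHit (sleTrace 6 ω) S' = t ∧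
        Disjoint (Loewner.closedHull (sleDriving 6 ω) t) A) →
    ∀ T : Set (CurveClass ℂ), MeasurableSet T →
      Process.preWienerMeasure {ω | stoppedPathClass (starMap A) (sleTrace 6 ω)
          ((firstHit (sleTrace 6 ω) S').untopD 0) ∈ T} =
        Process.preWienerMeasure {ω | stoppedPathClass id (sleTrace 6 ω)
          ((firstHit (sleTrace 6 ω) S).untopD 0) ∈ T}

/-- **Locality of chordal SLE₆ with respect to a `*`-hull, half-plane form, NEIGHBOURHOOD version**:
same as `sle_six_hull_locality` (curve-hitting hypothesis), with the extra hypothesis that the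
stopping set `S'` contains a uniform neighbourhood of `A` in the closed half-plane — the form
actually consumed by the Jordan-domain reduction (`G ⊇ F_δ` there), in which the hull can swallow
only finitely many clusters of `A` before the curve enters `S'`, so that the passage from the
alive form `sle_six_hull_locality_alive` is a finite iteration of the strong Markov property at
the successive hull-contact (swallowing) times. [cite: LawlerSchrammWerner2001, Thm 2.2] -/
def sle_six_hull_locality_nbhd : Prop :=
  ∀ {A : Set ℂ}, IsStarHull A → A.Nonempty → ∀ {S S' : Set ℂ}, IsClosed S → IsClosed S' →
    (∀ z : ℂ, 0 ≤ z.im → z ∉ A → (z ∈ S' ↔ starMap A z ∈ S)) →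
    (∃ δ : ℝ, 0 < δ ∧ ∀ z : ℂ, 0 ≤ z.im → Metric.infDist z A ≤ δ → z ∈ S') →
    (∀ᵐ ω ∂Process.preWienerMeasure, firstHit (sleTrace 6 ω) S' < firstHit (sleTrace 6 ω) A) →
    ∀ T : Set (CurveClass ℂ), MeasurableSet T →
      Process.preWienerMeasure {ω | stoppedPathClass (starMap A) (sleTrace 6 ω)
          ((firstHit (sleTrace 6 ω) S').untopD 0) ∈ T} =
        Process.preWienerMeasure {ω | stoppedPathClass id (sleTrace 6 ω)
          ((firstHit (sleTrace 6 ω) S).untopD 0) ∈ T}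

/-- The curve-hitting form trivially implies the neighbourhood form. [folklore] -/
theorem sle_six_hull_locality_nbhd_of (h : sle_six_hull_locality) : sle_six_hull_locality_nbhd :=
  fun hA hne _ _ hS hS' hdict _ hlt T hT ↦ h hA hne hS hS' hdict hlt T hT

end Literature.Probability.RandomPlanarGeometry

end
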